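import Summits.Ventures.HodgeKum4.Theorems.KummerFixedLocusL1HilbSuperLie
import Literature.AlgebraicGeometry.HilbertScheme.LefschetzDualTransfer
import HarnessLib

/-!
# Lane (V), line v2p5 — stub S-B: Lehn's formula `𝔊₀(y) = T₁(m_y)` for homogeneous `y` of ANY degree

Cell `hodge-kum4`, crux stmt-Ventures-20141, registered stub `stub_lehnSuper` of the v2p5 skeleton.  The tree's
`ChernCharacterOperators.cupOperator_zero_eq_transferOp_super` is the case `y = α ∈ H²`; the interface axiom
`ChernCharacterOperators.G_zero_bracket` (`[𝔊₀(γ), 𝔮ₘ(β)} = m 𝔮ₘ(γβ)`, SUPER-bracket with the parities `|γ|, |β|`) is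
stated for homogeneous `γ` of every degree, so with the parity-`p` transfer calculus of `…L1HilbSuperLie`
(`transferOp_superCommute`, `ext_of_superCommute`) the same uniqueness argument gives `𝔊₀(y) = T₁(y ∪ ·)` for `y ∈ Hˢ(S)`,
`s` arbitrary (odd `y`: the generators `m_x`, `|x| ∈ {1, 3}`, of the V2 mechanism).  [LQW Math. Ann. 2002 Thm 5.13 (iv);
Oberdieck 2021 (3.1), (3.5), Lemma 3.4.]  Nothing here asserts L1-Hilb(n) / L1 / HC_Kum4Type / HC.
-/

noncomputable section

open DirectSum
open scoped TensorProduct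
open Literature.AlgebraicTopology.SingularHomology
open Literature.AlgebraicGeometry Literature.AlgebraicGeometry.Hyperkaehler Literature.AlgebraicGeometry.HilbertScheme
open Literature.AlgebraicGeometry.HodgeTheory (complexBetti)
open Literature.AlgebraicGeometry.Motives (ComplexPoints SchemeOver IsSmoothProjective)

namespace Summit.Ventures.HodgeKum4.L1Hilb

variable {S : SchemeOver ℂ} {hS : IsSmoothProjective 2 S} {H : HilbertSchemesOfPoints S}

/-- Left cup product by a homogeneous class of degree `s` has parity `s`. -/
theorem totalCup_mem_paritySpan (s : ℕ) (y : complexBetti S s) (j : ℕ) (ε : complexBetti S j) :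
    totalCup ℂ (ComplexPoints S) (ofDegree ℂ (ComplexPoints S) s y) (ofDegree ℂ (ComplexPoints S) j ε) ∈
      paritySpan ℂ (coeffFamily S) (j + s) := by
  rw [totalCup_lof]
  exact lof_mem_paritySpan (A := coeffFamily S) ⟨j + s, by ring⟩ _

/-- (S-B) **Lehn's formula for homogeneous `y` of any degree** — registered stub `stub_lehnSuper` of the v2p5 skeleton of
crux stmt-Ventures-20141: `𝔊₀(y) = T₁(m_y)` (`m_y` = left cup product by `y`), even Casimir tensor. -/
theorem stub_lehnSuper (𝔊 : ChernCharacterOperators hS H)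
    {C : totalCohomology ℂ (ComplexPoints S) ⊗[ℂ] totalCohomology ℂ (ComplexPoints S)}
    (hCg : C ∈ evenTensorSpan ℂ (coeffFamily S)) (hC : IsCasimir ℂ (poincarePairing hS) C) (s : ℕ)
    (y : complexBetti S s) :
    𝔊.cupOperator 0 (ofDegree ℂ (ComplexPoints S) s y) =
      transferOp ℂ 𝔊.q C 1 (totalCup ℂ (ComplexPoints S) (ofDegree ℂ (ComplexPoints S) s y)) := by
  refine SuperLie.ext_of_superCommute 𝔊.isHeisenberg ?_ (fun k ↦ (-1 : ℂ) ^ (s * k)) ?_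
  · rw [𝔊.cupOperator_vacuum, transferOp_vac 𝔊.isHeisenberg C 1]
  · intro m hm k γ
    -- left: the interface axiom `[𝔊₀(y), 𝔮ₘ(γ)} = m 𝔮ₘ(y ∪ γ)`
    have hG := 𝔊.G_zero_bracket s y m k γ
    rw [superBracket] at hG
    -- right: the parity-`s` transfer commutator
    have hT := SuperLie.transferOp_superCommute 𝔊.isHeisenberg (poincarePairing_graded_symm hS) hCg hC 1
      (p := s) (φ := totalCup ℂ (ComplexPoints S) (ofDegree ℂ (ComplexPoints S) s y))
      (fun j ε ↦ totalCup_mem_paritySpan s y j ε) hm (lof_mem_paritySpan (A := coeffFamily S) ⟨k, rfl⟩ γ)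
    rw [zpow_one] at hT
    change 𝔊.cupOperator 0 (ofDegree ℂ (ComplexPoints S) s y) * 𝔊.q m (ofDegree ℂ (ComplexPoints S) k γ) -
        (-1 : ℂ) ^ (s * k) • (𝔊.q m (ofDegree ℂ (ComplexPoints S) k γ) * 𝔊.cupOperator 0 (ofDegree ℂ (ComplexPoints S) s y)) =
        _ at hG
    rw [hG]
    exact hT.symm

end Summit.Ventures.HodgeKum4.L1Hilb

end
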